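import Summits.HodgeConjecture.HodgeConjecture.Theorems.LinearSystemTorelliLocalTubeSpanTypedBasis
import Summits.HodgeConjecture.HodgeConjecture.Theorems.LinearSystemTorelliLocalTubeSpanLefschetzSplitting
import Summits.HodgeConjecture.HodgeConjecture.Theorems.LinearSystemTorelliLocalTubeSpanHardLefschetzMember
import Summits.HodgeConjecture.HodgeConjecture.Theorems.LinearSystemTorelliLocalTubeSpanNCNodal

/-!
# Route LinearSystemTorelli — crux `LocalTubeSpan` (stmt-HodgeConjecture-2490): the typed crux at a point from basis-wise detection (capstone of cycle 6)

Helper file (`--supports stmt-HodgeConjecture-2490`, line `Sketch` of the crux chain, cycle 6,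
continuation lead c5; compositions).

The typed candidate of the crux is the colimit form `LocalTubeSpanCFree` (crux workfile
`Lines/SketchTypedCandidate.lean`, revised in cycle 6): a class of `H¹(π₁(U, s), (V_van)_s)`
undetected by every element of the local subgroups of some neighbourhood of `t₀` lies in
`localKernel … t₀`.  This file states it, per point `t₀`, with ALL non-geometric hypotheses
discharged:

* `localTubeSpan_cfree_at_of_basiswiseDetection` — for a hyperplane-section family of a smooth
  projective `(n+1)`-fold whose member has class `[X_s] = c·[H]` (`c ≠ 0`) for a hard Lefschetz
  structure `Λ` (so the Lefschetz splitting holds, `localTubeSpan_lefschetzSplitting` +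
  `localTubeSpan_bijective_cup_of_hardLefschetz`): a neighbourhood BASIS of `t₀` by sets with
  path-connected punctured preimage and `ℚ`-cyclic detection of the rational monodromy at ONE local
  subgroup per basic set ⇒ `LocalTubeSpanCFree` at `t₀` (`…_vanishing_of_rat_hasBasis_one`).  What
  remains is hypothesis (G): the Picard–Lefschetz presentation of that one local subgroup per basic
  set as a covered transvection configuration — e.g.
* `localTubeSpan_cfree_at_of_ncNodalBasis` — the NORMAL-CROSSING NODAL member UNCONDITIONALLY
  (full carrier `Rᵏ π_* ℂ`): along a neighbourhood basis, one local subgroup per basic set generated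
  by finitely many elements acting on `Hᵏ(X_s(ℂ); ℚ)` as Picard–Lefschetz transvections along
  pairwise orthogonal non-zero cycles of a nondegenerate form ⇒ the colimit form at `t₀`
  (`localTubeSpan_injective_evalCoinv_of_orthogonal_transvections` per basic set +
  `localTubeSpan_mem_localKernel_of_rat_hasBasis_one`).

No named facts; no `sorry`.
-/

-- `Summit.HodgeConjecture.HodgeConjecture.Theorems` is the mandated namespace (single-conjunct summit:
-- Sub = Summit), which `linter.dupNamespace` flags on every declaration; the lakefile turns the
-- linter off tree-wide (weak option), restated here so stand-alone elaboration is warning-free too.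
set_option linter.dupNamespace false

noncomputable section

open CategoryTheory groupCohomology
open _root_.Topology Filter
open Literature.AlgebraicGeometry Literature.AlgebraicGeometry.HodgeTheory
open Literature.AlgebraicTopology.SingularHomology

namespace Summit.HodgeConjecture.HodgeConjecture.Theorems

universe v

variable {𝒳 Sb : Motives.SchemeOver ℂ} {π : 𝒳 ⟶ Sb} {n : ℕ} {T : Type v} [TopologicalSpace T]

/-- **The typed crux at `t₀` (`LocalTubeSpanCFree`, vanishing carrier) from basis-wise detection,
with the Lefschetz splitting discharged from hard Lefschetz.**  Let `D` be a monodromy package of a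
hyperplane-section family `π` of the smooth projective `(n+1)`-fold `X` (`j : 𝒳 ⟶ X`), `μ` an
orientation family with Poincaré duality, `s ∈ U` a base point whose member has class
`i_* 1 = c·[H]`, `c ≠ 0`, for a hard Lefschetz structure `Λ` on `X`; let `ι : U → T` be continuous and
`(bs i)_{p i}` a basis of `𝓝 t₀` whose basic sets have path-connected `ι⁻¹ (bs i)` and carry one view
point at which Schnell's third map of the rational monodromy restricted to the local subgroup is
injective.  Then every class of `H¹(π₁(U, s), (V_van)_s)` undetected on the local subgroups of some
neighbourhood of `t₀` lies in `localKernel ι (D.vanishingLocalSystem μ hX _) s t₀`.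
[cite: Schnell2010, §7 Prop. 12 (local form)] [cite: BrosnanFangNiePearlstein2009, §1 eq. (1)] -/
theorem localTubeSpan_cfree_at_of_basiswiseDetection {X : Motives.SchemeOver ℂ} {j : 𝒳 ⟶ X}
    (ι : C(smoothFiberLocus π n, T)) (D : HyperplaneSectionLocalSystem π n j)
    (μ : OrientationFamily) (hμ : μ.HasPoincareDuality) (hX : Motives.IsSmoothProjective (n + 1) X)
    (s : smoothFiberLocus π n) (Λ : HardLefschetzNFold (n + 1) X) {c : ℂ} (hc : c ≠ 0)
    (hcls : complexGysin μ s.2 hX (Motives.fiberι π s.1 ≫ j) (show 0 + 2 * (n + 1) = 2 + 2 * n by omega)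
        (singularCohomology.one ℂ (Motives.ComplexPoints (Motives.fiberOver π s.1))) =
      c • Λ.hyperplaneClass)
    {ι' : Sort*} {p : ι' → Prop} {bs : ι' → Set T} {t₀ : T} (hbs : (𝓝 t₀).HasBasis p bs)
    (hdet : ∀ i, p i → IsPathConnected (ι ⁻¹' bs i) ∧
      ∃ (s' : smoothFiberLocus π n) (hs' : ι s' ∈ bs i) (γ : Path s' s),
        Function.Injective (evalCoinv (Rep.res (localSubgroup ι s (bs i) hs' γ).subtype
          (Rep.of (D.toDirectImageLocalSystem.ratMonodromy n s)))))
    (ξ : groupCohomology.H1 (monodromyRepObj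
      (D.vanishingLocalSystem μ hX (show n + 2 * (n + 1) = (n + 2) + 2 * n by omega)) s))
    (hξ : ∃ N ∈ 𝓝 t₀, ∀ (s' : smoothFiberLocus π n) (hs' : ι s' ∈ N) (γ : Path s' s),
      evalCoinvOn (monodromyRepObj
        (D.vanishingLocalSystem μ hX (show n + 2 * (n + 1) = (n + 2) + 2 * n by omega)) s)
        (localSubgroup ι s N hs' γ) ξ = 0) :
    ξ ∈ localKernel ι (D.vanishingLocalSystem μ hX (show n + 2 * (n + 1) = (n + 2) + 2 * n by omega))
      s t₀ :=
  localTubeSpan_mem_localKernel_vanishing_of_rat_hasBasis_one ι D μ hX _ s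
    (localTubeSpan_lefschetzSplitting μ hμ hX _ s _ rfl
      (localTubeSpan_bijective_cup_of_hardLefschetz Λ hc hcls rfl))
    hbs hdet ξ hξ

/-- **The normal-crossing nodal member along a neighbourhood basis, UNCONDITIONALLY (full carrier).**
For the direct-image local system `Rᵏ π_* ℂ|_U` of a smooth projective family, a base point `s`, a
continuous `ι : U → T` and a basis `(bs i)_{p i}` of `𝓝 t₀` such that every basic set has
path-connected `ι⁻¹ (bs i)` and ONE local subgroup generated by finitely many elements acting on
`Hᵏ(X_s(ℂ); ℚ)` through the rational monodromy as Picard–Lefschetz transvections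
`x ↦ x - B(x, δᵢ) δᵢ` along pairwise `B`-orthogonal non-zero cycles of a nondegenerate form `B`
(several nodes: local `π₁` generated by the meridians, Picard–Lefschetz formula, disjoint vanishing
spheres): every class undetected on the local subgroups of some neighbourhood of `t₀` lies in
`localKernel ι (D.V k) s t₀` — the colimit form of the crux at `t₀`, with no named fact.
[cite: Schnell2010, §7 Prop. 12 (local form)] [cite: VoisinHodgeII2003, Thm. 3.16] -/
theorem localTubeSpan_cfree_at_of_ncNodalBasis (ι : C(smoothFiberLocus π n, T))
    (D : DirectImageLocalSystem π n) (k : ℕ) (s : smoothFiberLocus π n)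
    {ι' : Sort*} {p : ι' → Prop} {bs : ι' → Set T} {t₀ : T} (hbs : (𝓝 t₀).HasBasis p bs)
    (hnc : ∀ i, p i → IsPathConnected (ι ⁻¹' bs i) ∧
      ∃ (s' : smoothFiberLocus π n) (hs' : ι s' ∈ bs i) (γ : Path s' s)
        (B : LinearMap.BilinForm ℚ (Motives.bettiCohomology (Motives.fiberOver π s.1) k))
        (r : ℕ) (t : Fin r → localSubgroup ι s (bs i) hs' γ)
        (δ : Fin r → Motives.bettiCohomology (Motives.fiberOver π s.1) k),
        B.Nondegenerate ∧ Subgroup.closure (Set.range t) = ⊤ ∧ (∀ a, δ a ≠ 0) ∧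
        (∀ (a : Fin r) (x : Motives.bettiCohomology (Motives.fiberOver π s.1) k),
          D.ratMonodromy k s (t a : FundamentalGroup (smoothFiberLocus π n) s) x =
            x - B x (δ a) • δ a) ∧
        (∀ a a', B (δ a) (δ a') = 0))
    (ξ : groupCohomology.H1 (monodromyRepObj (D.V k) s))
    (hξ : ∃ N ∈ 𝓝 t₀, ∀ (s' : smoothFiberLocus π n) (hs' : ι s' ∈ N) (γ : Path s' s),
      evalCoinvOn (monodromyRepObj (D.V k) s) (localSubgroup ι s N hs' γ) ξ = 0) :
    ξ ∈ localKernel ι (D.V k) s t₀ := by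
  refine localTubeSpan_mem_localKernel_of_rat_hasBasis_one ι D k s hbs (fun i hi => ?_) ξ hξ
  obtain ⟨hpc, s', hs', γ, B, r, t, δ, hB, ht, hδ, hPL, horth⟩ := hnc i hi
  refine ⟨hpc, s', hs', γ, ?_⟩
  haveI : FiniteDimensional ℚ
      (Rep.res (localSubgroup ι s (bs i) hs' γ).subtype (Rep.of (D.ratMonodromy k s))).V :=
    (localTubeSpan_ratTensorEquiv D k s _ (D.ofRatClass_ratMonodromy k s)).1
  exact localTubeSpan_injective_evalCoinv_of_orthogonal_transvections
    (Rep.res (localSubgroup ι s (bs i) hs' γ).subtype (Rep.of (D.ratMonodromy k s))) B hB t ht δ hδ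
    (fun a x => hPL a x) horth

end Summit.HodgeConjecture.HodgeConjecture.Theorems

end
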